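import Literature.NumberTheory.DiophantineGeometry.FibreConductorCritJunction
import Literature.NumberTheory.DiophantineGeometry.GenEllDeFamilyBadPrimes
import HarnessLib

/-!
# [GenEll] Thm. 2.1 on the `D_e` route, family `t_c`: the conductor slope off the bad primes `S(e, c)`

S. Mochizuki, *Arithmetic elliptic curves in general position*, Math. J. Okayama Univ. 52 (2010),
Prop. 1.6 p. 10 (reduced divisor) as used in the proof of Thm. 2.1 pp. 12–13
[cite: MochizukiGenEll2010, Prop 1.6 p.10]. Support file for the route item `GenEllTwo` (stmt-ABC-19679),
W5 coordinator abc-iut-w5-d045; classical, nothing here bears on [IUTchIII] Cor. 3.12.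

THE FINAL W5 STATEMENT for the W9 assembly (R-a″, B-free place set): for `k` (`e = 2k+1`), a parameter
`c ≠ 0` and the finite set `A` of critical values of `t_c` over a number field `K`, there is ONE finite set
`S(e, c) ∋ 2` of rational primes (`DeC.exists_badPrimes`, B-free, configuration-free) such that for every
number field `L ⊇ K`, every finite `T ⊇ S`, every point `(r, s, t)` of `D_e` over `L` with `t = t_c`,
`N = N_c ≠ 0`, every finite `B ⊇ A` with `t ∉ B`, every finite set `W` of places meeting `B` off
`Sbad := ⋃_{p∈T} placesOver L p`, given the converse direction at `A` off `Sbad` (package W5c) and the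
analytic/height inputs (`hbad₁`, `hbad₂` over `Sbad`; `harch`; `ht`, `hN`, `hB`), the conductor slope
holds:

  `(1/[L:ℚ]) Σ_{w∈W} log N(w) ≤ ((|B|(2k+4) − (6k+6))/(2k+1))·(1/[L:ℚ])·h_L(x) + const`

(abc-iut-w5-d023's B-free junction `DeC.inv_finrank_mul_sum_logNorm_le_slope_of_crit` with its four
placewise good-reduction hypotheses discharged by `DeC.exists_badPrimes`).
-/

noncomputable section

namespace Literature.NumberTheory.DiophantineGeometry.GenEll

open _root_.Polynomial NumberField IsDedekindDomain
open Literature.IUT.LogVolume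

universe u

variable {K : Type u} [Field K] [NumberField K]

open scoped Classical in
/-- **The conductor slope for the family `t_c` off the bad primes `S(e, c)`** ([GenEll] Prop. 1.6, sharp
form on `D_e`, summed over all places; B-free place set): see the module docstring. The only inputs left
per point are the converse direction at the critical values (`hconvA`), the meeting property of `W`
(`hW`), the bad-place/archimedean bounds (`hbad₁`, `hbad₂`, `harch`) and the height comparisons
(`htH`, `hNH`, `hBH`). [cite: MochizukiGenEll2010, Prop 1.6 p.10] -/
theorem DeC.slope_of_crit_off_badPrimes (k : ℕ) {c : K} (hc : c ≠ 0) (A : Finset K) :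
    ∃ S : Finset ℕ, 2 ∈ S ∧ (∀ p ∈ S, p.Prime) ∧
      ∀ (L : Type u) [Field L] [NumberField L] [Algebra K L] (T : Finset ℕ), S ⊆ T →
        ∀ {r s t N x : L},
        s ^ 2 = 1 - 4 * r ^ (2 * k + 1) → t * (r * s) = s + algebraMap K L c * r ^ (k + 2) →
        N = -s ^ 3 + algebraMap K L c * ((k + 1) * r ^ (k + 2) - 2 * r ^ (3 * k + 3)) → N ≠ 0 →
        ∀ (B : Finset L), A.map ⟨algebraMap K L, (algebraMap K L).injective⟩ ⊆ B →
        (∀ b ∈ B, t ≠ b) →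
        ∀ (W : Finset (HeightOneSpectrum (𝓞 L))) {C₁ C₂ C₃ C₄ C₅ C₆ : ℝ},
        (∀ w : HeightOneSpectrum (𝓞 L), w ∉ T.attach.biUnion (fun p => placesOver L p.1) →
          w.valuation L N < 1 →
            ∃ a ∈ A.map ⟨algebraMap K L, (algebraMap K L).injective⟩, w.valuation L (t - a) < 1) →
        (∀ w ∈ W, w ∉ T.attach.biUnion (fun p => placesOver L p.1) → ∃ b ∈ B, 0 < ord L w (t - b)) →
        (∑ w ∈ T.attach.biUnion (fun p => placesOver L p.1),
            ((ord L w N).toNat : ℝ) * logNorm L w ≤ Module.finrank ℚ L * C₁) →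
        (∑ w ∈ T.attach.biUnion (fun p => placesOver L p.1), logNorm L w ≤ Module.finrank ℚ L * C₂) →
        (∀ v : InfinitePlace L, Real.posLog (v N⁻¹) ≤ C₃) →
        ((2 * k + 1 : ℝ) * Height.logHeight₁ t ≤
          (2 * k + 4 : ℝ) * Height.logHeight₁ x + Module.finrank ℚ L * C₄) →
        ((6 * k + 6 : ℝ) * Height.logHeight₁ x ≤
          (2 * k + 1 : ℝ) * Height.logHeight₁ N + Module.finrank ℚ L * C₅) →
        (∀ b ∈ B, Height.logHeight₁ b ≤ Module.finrank ℚ L * C₆) →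
        (Module.finrank ℚ L : ℝ)⁻¹ * ∑ w ∈ W, logNorm L w ≤
          ((B.card * (2 * k + 4 : ℝ) - (6 * k + 6)) / (2 * k + 1)) *
              ((Module.finrank ℚ L : ℝ)⁻¹ * Height.logHeight₁ x) +
            ((B.card * C₄ + C₅) / (2 * k + 1) + B.card * (C₆ + Real.log 2) + C₁ + C₂ + C₃) := by
  classical
  obtain ⟨S, h2S, hSp, hS⟩ := DeC.exists_badPrimes (K := K) k hc A
  refine ⟨S, h2S, hSp, ?_⟩
  intro L _ _ _ T hST r s t N x hcurve ht hN hN0 B hAB htB W C₁ C₂ C₃ C₄ C₅ C₆ hconvA hW hbad₁ hbad₂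
    harch htH hNH hBH
  set ι : K ↪ L := ⟨algebraMap K L, (algebraMap K L).injective⟩ with hι
  set Sbad := T.attach.biUnion (fun p => placesOver L p.1) with hSbad
  have hmono : ∀ w : HeightOneSpectrum (𝓞 L), w ∉ Sbad →
      w ∉ S.attach.biUnion (fun p => placesOver L p.1) := by
    intro w hw hwS
    obtain ⟨p, -, hp⟩ := Finset.mem_biUnion.mp hwS
    exact hw (Finset.mem_biUnion.mpr ⟨⟨p.1, hST p.2⟩, Finset.mem_attach _ _, hp⟩)
  refine DeC.inv_finrank_mul_sum_logNorm_le_slope_of_crit k hcurve ht hN hN0 (A.map ι) B hAB htB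
    (fun d => C ((algebraMap K L c) ^ 2) * X ^ (2 * k + 4) + C (4 * d ^ 2) * X ^ (2 * k + 3)
      - C (8 * d) * X ^ (2 * k + 2) + C 4 * X ^ (2 * k + 1) - C (d ^ 2) * X ^ 2 + C (2 * d) * X - 1)
    (fun _ _ => rfl) Sbad W ?_ ?_ ?_ ?_ hconvA hW hbad₁ hbad₂ harch htH hNH hBH
  · intro w hw
    exact (hS L w (hmono w hw)).1
  · intro w hw
    exact (hS L w (hmono w hw)).2.1
  · intro w hw a ha
    obtain ⟨a₀, ha₀, rfl⟩ := Finset.mem_map.mp ha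
    exact (hS L w (hmono w hw)).2.2.1 a₀ ha₀
  · intro w hw a ha ρ hρ hg0 hlt
    obtain ⟨a₀, ha₀, rfl⟩ := Finset.mem_map.mp ha
    exact (hS L w (hmono w hw)).2.2.2.2 a₀ ha₀ _ rfl ρ hρ hg0 hlt

end Literature.NumberTheory.DiophantineGeometry.GenEll
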